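import Literature.Computability.Cryptography.VanDamSeroussiCubicBlockSemantics
import HarnessLib

/-!
# The quantum block of the cubic Gauss-sum experiment, III: the state before and after the eigenvalue measurement

Topic `Literature/Computability/Cryptography`; sequel of `VanDamSeroussiCubicBlockSemantics.lean`. From
`|0…0⟩` the constants, preparation and repetition stages of the block produce (van Dam–Seroussi
2002, §4, proof of Thm. 1, steps 1–2, in the tree's Fourier-free realisation)

`2^{-(1+λ)/2} Σ_j |x₀; Y = jp⟩ + 2^{-(1+n+λ)/2} Σ_{s good} Σ_j |x₁; Y = s + jp⟩ + (flagged junk)`,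

`x₀` the first part with the constants in place, `x₁` the same with the control set, "good" the
members `s` of the coset `C_{c'}` of cubes (`flagVal 1 s p r c' = false`), and the junk carrying the
flag `f = 1` (`blockPre_eq`). Kitaev's circuit then turns each `|x; Y = v⟩` into
`2^{-k} Σ_{y,γ} (-i)^{#σ∧y} (-1)^{y·γ} |x, γ; P = (v + E(y)) mod N⟩` (`peCirc_mulVec_good`, from
`kitaevCircuit_mulVec_superposition` and `A_good`), and keeps flagged labels flagged
(`peCirc_mulVec_flagged`).

Everything here is proved; no named fact is introduced.

## References

* W. van Dam, G. Seroussi, arXiv:quant-ph/0207131 (2002), §4 Thm. 1 (proof) [VanDamSeroussi2002].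
* A. Yu. Kitaev, arXiv:quant-ph/9511026 (1995), §3 (Remark 8, Lemma 8, Lemma 10), §5 [Kitaev1995].
-/

noncomputable section

namespace Literature.Computability.Cryptography

namespace VanDamSeroussi

namespace CubicBlock

open _root_.Computability Complexity QuantumComplexity QuantumComplexity.RevSim QuantumComplexity.RevClean Kitaev1995 Matrix
  Finset

namespace Layout

variable (Λ : Layout)

/-! ### Small facts about `setReg`, the flag and the good values -/

/-- Overwriting a register with the value it already holds. [folklore] -/
theorem setReg_eq_self {p₀ w : ℕ} (hpw : p₀ + w ≤ Λ.n₁) (x : QReg Λ.n₁) (s : ℕ)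
    (h : ∀ i (hi : i < w), x ⟨p₀ + i, by omega⟩ = s.testBit i) : Λ.setReg p₀ w x s = x := by
  funext q
  by_cases hq : p₀ ≤ (q : ℕ) ∧ (q : ℕ) < p₀ + w
  · obtain ⟨i, hi, hqi⟩ : ∃ i, ∃ hi : i < w, q = ⟨p₀ + i, by omega⟩ := ⟨q - p₀, by omega, Fin.ext (by simp only; omega)⟩
    rw [hqi, Λ.setReg_of_mem _ _ hi, h i hi]
  · exact Λ.setReg_of_not _ _ hq

/-- Overwriting twice. [folklore] -/
theorem setReg_setReg {p₀ w : ℕ} (x : QReg Λ.n₁) (s s' : ℕ) : Λ.setReg p₀ w (Λ.setReg p₀ w x s) s' = Λ.setReg p₀ w x s' := by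
  funext q
  by_cases hq : p₀ ≤ (q : ℕ) ∧ (q : ℕ) < p₀ + w
  · simp [setReg, hq]
  · simp [setReg, hq]

/-- A value with a clear flag is a member of the coset: in particular `s < p`. [folklore] -/
theorem lt_of_flagVal_false {s p r cp : ℕ} (h : flagVal 1 s p r cp = false) : s < p := by
  unfold flagVal at h
  simp only [decide_true, Bool.true_and, Bool.not_eq_false', Bool.and_eq_true, decide_eq_true_eq] at h
  exact h.1.2

/-- The good values: members of the coset `C_{c'}`. [cite: VanDamSeroussi2002, §2.1] -/
def goodS (d : Data) : Finset ℕ := (range (2 ^ Λ.n)).filter fun s => flagVal 1 s d.p d.r d.cp = false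

/-- The junk values. [folklore] -/
def junkS (d : Data) : Finset ℕ := (range (2 ^ Λ.n)).filter fun s => ¬flagVal 1 s d.p d.r d.cp = false

/-- The first part of the idle branch: constants in place. [folklore] -/
def x₀ (d : Data) : QReg Λ.n₁ := Λ.cx d

/-- The first part of the active branch: constants in place and the control set. [folklore] -/
def x₁ (d : Data) : QReg Λ.n₁ := Λ.xc (Λ.x₀ d) true

/-- The first part of a junk label before the repetition stage. [folklore] -/
def xJ (d : Data) (s : ℕ) : QReg Λ.n₁ := Λ.xf (Λ.xX (Λ.x₁ d) s) true

/-- `x₀` is the first part after the constants stage (definitional). [folklore] -/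
theorem x₀_def (d : Data) : Λ.x₀ d = Λ.cx d := rfl

/-- `x₁` is `x₀` with the control set (definitional). [folklore] -/
theorem x₁_def (d : Data) : Λ.x₁ d = Λ.xc (Λ.x₀ d) true := rfl

/-! ### The state before the eigenvalue measurement -/

section Pre

variable {d : Data} (hd : Λ.DataOK d)
include hd

omit hd in
/-- Register values of `x₀`: everything before the constants is clean. [folklore] -/
theorem x₀_of_lt_cs {q : ℕ} (hq : q < Λ.cs) (ht : Λ.tau < q) (h : q < Λ.n₁) : Λ.x₀ d ⟨q, h⟩ = false := Λ.cx_of_lt_cs d hq ht h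

omit hd in
/-- The coin `τ` of the component. [folklore] -/
theorem x₀_tau : Λ.x₀ d ⟨Λ.tau, Λ.tau_lt_n₁⟩ = d.im := Λ.cx_tau d

omit hd in
/-- Register values of `x₁` off the control. [folklore] -/
theorem x₁_of_ne_c {q : ℕ} (hq : q ≠ Λ.c) (h : q < Λ.n₁) : Λ.x₁ d ⟨q, h⟩ = Λ.x₀ d ⟨q, h⟩ := by
  rw [x₁_def, xc, Function.update_of_ne]
  exact fun h' => hq (congrArg Fin.val h')

omit hd in
/-- `x₀` is good for `V`. [folklore] -/
theorem x₀_good : Λ.XGood (Λ.x₀ d) := Λ.cx_good d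

omit hd in
/-- `x₁` is good for `V` (the control is not in the area nor a constant). [folklore] -/
theorem x₁_good : Λ.XGood (Λ.x₁ d) := by
  obtain ⟨hccs, -, -, -, -, hcsas⟩ := Λ.lt_cs_facts
  refine ⟨fun q hq hle => ?_, fun i hi => ?_, fun i hi => ?_⟩
  · rw [Λ.x₁_of_ne_c (by omega)]; exact (Λ.cx_good d).area q hq hle
  · rw [Λ.x₁_of_ne_c (by have := Λ.Nreg_lt_as hi; unfold Nreg at this ⊢; omega)]; exact (Λ.cx_good d).nreg i hi
  · rw [Λ.x₁_of_ne_c (by have := Λ.BPreg_lt_as hi; unfold BPreg at this ⊢; omega)]; exact (Λ.cx_good d).bpreg i hi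

omit hd in
/-- The hypotheses of `rmap_good` for a first part that agrees with `x₀` on the constants and is clean
on `J` and the area. [folklore] -/
theorem consts_of_eq_x₀ (x : QReg Λ.n₁) (hx : ∀ q (h : q < Λ.n₁), (Λ.cs ≤ q ∨ q < Λ.ℓ) → x ⟨q, h⟩ = Λ.x₀ d ⟨q, h⟩) :
    (∀ q (hq : q < Λ.n₁), Λ.as ≤ q → x ⟨q, hq⟩ = false) ∧ (∀ i, i < Λ.n → Λ.xv x (Λ.Preg i) = d.p.testBit i) ∧
      (∀ i, i < Λ.n + 1 → Λ.xv x (Λ.T2n i) = (2 ^ Λ.n).testBit i) := by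
  obtain ⟨-, -, -, -, -, hcsas⟩ := Λ.lt_cs_facts
  have has := Λ.as_le_n₁
  refine ⟨fun q hq hle => ?_, fun i hi => ?_, fun i hi => ?_⟩
  · rw [hx q hq (Or.inl (by omega))]; exact Λ.cx_of_as_le d hle _
  · have h1 := Λ.Preg_lt_as hi
    rw [Λ.xv_of_lt _ (by omega), hx _ _ (Or.inr (by unfold Preg ℓ; omega))]; exact Λ.cx_Preg d hi _
  · have h1 := Λ.T2n_lt_as hi
    rw [Λ.xv_of_lt _ (by omega), hx _ _ (Or.inl (by unfold T2n; omega))]; exact Λ.cx_T2n d hi _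

/-- **The idle branch after the repetition stage**: `Y = jp`. [cite: VanDamSeroussi2002, §4 Thm. 1 (proof)] -/
theorem rmap_x₀ (hp : 0 < d.p) {jv : ℕ} (hjv : jv < 2 ^ Λ.lam) :
    Λ.rmap (Λ.x₀ d) jv = tri (Λ.x₀ d) (fun _ => false) (Λ.yp (jv * d.p) 0) := by
  obtain ⟨hccs, hXcs, hfcs, hJcs, hXf, hcsas⟩ := Λ.lt_cs_facts
  have has := Λ.as_le_n₁
  obtain ⟨harea, hP, hT⟩ := Λ.consts_of_eq_x₀ (d := d) (Λ.x₀ d) fun _ _ _ => rfl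
  have hX : ∀ i, i < Λ.n → Λ.xv (Λ.x₀ d) (Λ.X i) = (0 : ℕ).testBit i := fun i hi => by
    rw [Λ.xv_of_lt _ (by have := Λ.X_lt_as hi; omega), Nat.zero_testBit]; exact Λ.x₀_of_lt_cs (hXcs i hi) (by unfold X tau; omega) _
  have hJ : ∀ i, i < Λ.lam → Λ.xv (Λ.x₀ d) (Λ.J i) = false := fun i hi => by
    rw [Λ.xv_of_lt _ (by have := Λ.J_lt_as hi; omega)]; exact Λ.x₀_of_lt_cs (hJcs i hi) (by unfold J tau; omega) _
  rw [Λ.rmap_good hd (Λ.x₀ d) harea hp hX hJ hP hT hjv, Nat.zero_add,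
    Λ.setReg_eq_self Λ.X0_add_le _ _ fun i hi => by
      rw [Nat.zero_testBit]; exact Λ.x₀_of_lt_cs (by have := hXcs i hi; unfold X at this ⊢; omega) (by unfold X tau; omega) _]

/-- **A good label of the active branch after the repetition stage**: `Y = s + jp`. [cite: VanDamSeroussi2002, §4 Thm. 1 (proof)] -/
theorem rmap_x₁ {s : ℕ} (hs : s ∈ Λ.goodS d) {jv : ℕ} (hjv : jv < 2 ^ Λ.lam) :
    Λ.rmap (Λ.xf (Λ.xX (Λ.x₁ d) s) (flagVal 1 s d.p d.r d.cp)) jv = tri (Λ.x₁ d) (fun _ => false) (Λ.yp (s + jv * d.p) 0) := by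
  obtain ⟨hccs, hXcs, hfcs, hJcs, hXf, hcsas⟩ := Λ.lt_cs_facts
  have has := Λ.as_le_n₁; have hXle := Λ.X0_add_le
  rw [goodS, mem_filter, mem_range] at hs
  obtain ⟨hs2, hflag⟩ := hs
  have hsp : s < d.p := lt_of_flagVal_false hflag
  have hcX : Λ.c < Λ.X 0 := by unfold c X; omega
  -- the flag is clear: `xf _ false` is the identity
  have hxXf : Λ.xX (Λ.x₁ d) s ⟨Λ.f, Λ.f_lt_n₁⟩ = false := by
    rw [xX, Λ.setReg_of_not _ _ (by simp only; omega), Λ.x₁_of_ne_c (q := Λ.f) (by omega)]; exact Λ.x₀_of_lt_cs hfcs (by unfold f tau; omega) _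
  rw [hflag, show Λ.xf (Λ.xX (Λ.x₁ d) s) false = Λ.xX (Λ.x₁ d) s from Function.update_eq_self_iff.2 hxXf.symm]
  -- register values of `xX x₁ s`
  have hoff : ∀ q (hq : q < Λ.n₁), ¬(Λ.X 0 ≤ q ∧ q < Λ.X 0 + Λ.n) → q ≠ Λ.c → Λ.xX (Λ.x₁ d) s ⟨q, hq⟩ = Λ.x₀ d ⟨q, hq⟩ :=
    fun q hq h1 h2 => by rw [xX, Λ.setReg_of_not _ _ (by simpa using h1), Λ.x₁_of_ne_c h2]
  obtain ⟨harea, hP, hT⟩ := Λ.consts_of_eq_x₀ (d := d) (Λ.xX (Λ.x₁ d) s) fun q h hle =>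
    hoff q h (by have e1 : Λ.cs = Λ.ℓ + 3 + Λ.n + Λ.lam := rfl; have e2 : Λ.ℓ = 2 * Λ.n := rfl; unfold X; omega)
      (by have e1 : Λ.cs = Λ.ℓ + 3 + Λ.n + Λ.lam := rfl; have e2 : Λ.ℓ = 2 * Λ.n := rfl; unfold c; omega)
  have hX : ∀ i, i < Λ.n → Λ.xv (Λ.xX (Λ.x₁ d) s) (Λ.X i) = s.testBit i := fun i hi => by
    have hXi : Λ.X i = Λ.X 0 + i := by unfold X; omega
    rw [Λ.xv_of_lt _ (by omega), show (⟨Λ.X i, (by omega : Λ.X i < Λ.n₁)⟩ : Fin Λ.n₁) = ⟨Λ.X 0 + i, by omega⟩ from Fin.ext hXi,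
      xX, Λ.setReg_of_mem _ _ hi]
  have hJ : ∀ i, i < Λ.lam → Λ.xv (Λ.xX (Λ.x₁ d) s) (Λ.J i) = false := fun i hi => by
    have h1 := hJcs i hi
    rw [Λ.xv_of_lt _ (by omega), hoff (Λ.J i) _ (by unfold J X; omega) (by unfold J c; omega)]
    exact Λ.x₀_of_lt_cs h1 (by unfold J tau; omega) _
  rw [Λ.rmap_good hd _ harea hsp hX hJ hP hT hjv, xX, Λ.setReg_setReg,
    Λ.setReg_eq_self Λ.X0_add_le _ _ fun i hi => by
      rw [Nat.zero_testBit, Λ.x₁_of_ne_c (q := Λ.X 0 + i) (by unfold c X; omega)]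
      exact Λ.x₀_of_lt_cs (by have := hXcs i hi; unfold X at this ⊢; omega) (by unfold X tau; omega) _]

omit hd in
/-- A junk label keeps its flag through the repetition stage. [folklore] -/
theorem rmap_xJ_flag (s jv : ℕ) : Λ.rmap (Λ.xJ d s) jv (Λ.fin Λ.f) = true := by
  rw [Λ.rmap_fin_f, xJ, xf]
  exact Function.update_self _ _ _

/-- **The state of the block before the eigenvalue measurement.**
[cite: VanDamSeroussi2002, §4 Thm. 1 (proof, steps 1–2)] -/
theorem blockPre_mulVec (hp : 0 < d.p) :
    Λ.repCirc.toMatrix 0 *ᵥ (Λ.prepCirc.toMatrix 0 *ᵥ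
      basisState (tri (Λ.x₀ d) (fun _ : Fin Λ.k => false) (fun _ : Fin (Λ.kap + Λ.kap) => false))) =
      (invSqrt2 * invSqrt2 ^ Λ.lam) • ∑ jv ∈ range (2 ^ Λ.lam), basisState (tri (Λ.x₀ d) (fun _ : Fin Λ.k => false) (Λ.yp (jv * d.p) 0)) +
      (invSqrt2 * invSqrt2 ^ Λ.n * invSqrt2 ^ Λ.lam) •
        ∑ s ∈ Λ.goodS d, ∑ jv ∈ range (2 ^ Λ.lam), basisState (tri (Λ.x₁ d) (fun _ : Fin Λ.k => false) (Λ.yp (s + jv * d.p) 0)) +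
      (invSqrt2 * invSqrt2 ^ Λ.n * invSqrt2 ^ Λ.lam) •
        ∑ s ∈ Λ.junkS d, ∑ jv ∈ range (2 ^ Λ.lam), basisState (Λ.rmap (Λ.xJ d s) jv) := by
  obtain ⟨hccs, hXcs, hfcs, hJcs, hXf, hcsas⟩ := Λ.lt_cs_facts
  have has := Λ.as_le_n₁; have hXle := Λ.X0_add_le; have hJle := Λ.J0_add_le
  have hcX : Λ.c < Λ.X 0 := by unfold c X; omega
  have hJ₀ : ∀ i (hi : i < Λ.lam), Λ.x₀ d ⟨Λ.J 0 + i, by omega⟩ = false := fun i hi =>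
    Λ.x₀_of_lt_cs (by have := hJcs i hi; unfold J at this ⊢; omega) (by unfold J tau; omega) _
  have hJ₁ : ∀ s i (hi : i < Λ.lam), Λ.xf (Λ.xX (Λ.x₁ d) s) (flagVal 1 s d.p d.r d.cp) ⟨Λ.J 0 + i, by omega⟩ = false := by
    intro s i hi
    rw [xf, Function.update_of_ne (fun h => by have := congrArg Fin.val h; simp only at this; unfold J f at this; omega), xX,
      Λ.setReg_of_not _ _ (by simp only; unfold J X; omega), Λ.x₁_of_ne_c (q := Λ.J 0 + i) (by unfold J c; omega)]
    exact hJ₀ i hi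
  have hsum : ∑ s ∈ range (2 ^ Λ.n), Λ.repCirc.toMatrix 0 *ᵥ
      basisState (tri (Λ.xf (Λ.xX (Λ.xc (Λ.x₀ d) true) s) (flagVal 1 s d.p d.r d.cp)) (fun _ => false) (fun _ => false)) =
      ∑ s ∈ range (2 ^ Λ.n), invSqrt2 ^ Λ.lam • ∑ jv ∈ range (2 ^ Λ.lam),
        basisState (Λ.rmap (Λ.xf (Λ.xX (Λ.x₁ d) s) (flagVal 1 s d.p d.r d.cp)) jv) :=
    sum_congr rfl fun s _ => Λ.repCirc_mulVec _ (hJ₁ s)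
  have h0 : ∑ jv ∈ range (2 ^ Λ.lam), basisState (Λ.rmap (Λ.x₀ d) jv) =
      ∑ jv ∈ range (2 ^ Λ.lam), basisState (tri (Λ.x₀ d) (fun _ : Fin Λ.k => false) (Λ.yp (jv * d.p) 0)) :=
    sum_congr rfl fun jv hjv => by rw [Λ.rmap_x₀ hd hp (mem_range.1 hjv)]
  have h1 : ∑ s ∈ (range (2 ^ Λ.n)).filter (fun s => flagVal 1 s d.p d.r d.cp = false), invSqrt2 ^ Λ.lam •
      ∑ jv ∈ range (2 ^ Λ.lam), basisState (Λ.rmap (Λ.xf (Λ.xX (Λ.x₁ d) s) (flagVal 1 s d.p d.r d.cp)) jv) =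
      invSqrt2 ^ Λ.lam • ∑ s ∈ Λ.goodS d, ∑ jv ∈ range (2 ^ Λ.lam),
        basisState (tri (Λ.x₁ d) (fun _ : Fin Λ.k => false) (Λ.yp (s + jv * d.p) 0)) := by
    rw [Finset.smul_sum]
    exact sum_congr rfl fun s hs => congrArg _ (sum_congr rfl fun jv hjv => by rw [Λ.rmap_x₁ hd hs (mem_range.1 hjv)])
  have h2 : ∑ s ∈ (range (2 ^ Λ.n)).filter (fun s => ¬flagVal 1 s d.p d.r d.cp = false), invSqrt2 ^ Λ.lam •
      ∑ jv ∈ range (2 ^ Λ.lam), basisState (Λ.rmap (Λ.xf (Λ.xX (Λ.x₁ d) s) (flagVal 1 s d.p d.r d.cp)) jv) =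
      invSqrt2 ^ Λ.lam • ∑ s ∈ Λ.junkS d, ∑ jv ∈ range (2 ^ Λ.lam), basisState (Λ.rmap (Λ.xJ d s) jv) := by
    rw [Finset.smul_sum]
    refine sum_congr rfl fun s hs => congrArg _ (sum_congr rfl fun jv _ => ?_)
    have hs' : ¬flagVal 1 s d.p d.r d.cp = false := (mem_filter.1 hs).2
    rw [show flagVal 1 s d.p d.r d.cp = true by simpa using hs']; rfl
  rw [x₀_def, Λ.prepCirc_mulVec hd, Matrix.mulVec_add, Matrix.mulVec_smul, Matrix.mulVec_smul, Matrix.mulVec_sum,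
    ← x₀_def, Λ.repCirc_mulVec _ hJ₀, smul_smul, hsum,
    ← sum_filter_add_sum_filter_not (range (2 ^ Λ.n)) (fun s => flagVal 1 s d.p d.r d.cp = false), h0, h1, h2, smul_add,
    smul_smul, smul_smul, add_assoc]

end Pre

/-! ### The eigenvalue measurement and the read-out on basis labels -/

/-- **Kitaev's circuit on one three-part label with clean tests** (the block `V` keeps the first part
and the tests, `V_mulVec_tri`). [cite: Kitaev1995, §3 (Remark 8, Lemma 8)] -/
theorem peCirc_mulVec_tri (x : QReg Λ.n₁) (ρ : QReg (Λ.kap + Λ.kap)) :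
    Λ.peCirc.toMatrix 0 *ᵥ basisState (tri x (fun _ : Fin Λ.k => false) ρ) =
      (invSqrt2 ^ Λ.k * invSqrt2 ^ Λ.k) •
        ∑ y : QReg Λ.k, ∑ y' : QReg Λ.k, (sPhase Λ.σ y * ySign y y') • basisState (tri x y' (Λ.A x y ρ)) := by
  classical
  have h := kitaevCircuit_mulVec_superposition (n := Λ.n₁) (k := Λ.k) (m := Λ.kap + Λ.kap) Λ.V Λ.σ (fun _ _ => True) Λ.A
    (fun x y ρ _ => Λ.V_mulVec_tri x y ρ) (fun x' ρ' => if x' = x ∧ ρ' = ρ then 1 else 0) (fun _ _ _ => trivial)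
  have hL : (∑ x' : QReg Λ.n₁, ∑ ρ' : QReg (Λ.kap + Λ.kap),
      (if x' = x ∧ ρ' = ρ then (1 : ℂ) else 0) • basisState (tri x' (fun _ : Fin Λ.k => false) ρ')) =
      basisState (tri x (fun _ : Fin Λ.k => false) ρ) := by
    rw [Finset.sum_eq_single x (fun x' _ hx' => Finset.sum_eq_zero fun ρ' _ => by rw [if_neg (fun h => hx' h.1), zero_smul])
      (fun h => absurd (Finset.mem_univ x) h),
      Finset.sum_eq_single ρ (fun ρ' _ hρ' => by rw [if_neg (fun h => hρ' h.2), zero_smul]) (fun h => absurd (Finset.mem_univ ρ) h),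
      if_pos ⟨rfl, rfl⟩, one_smul]
  have hR : (∑ x' : QReg Λ.n₁, ∑ ρ' : QReg (Λ.kap + Λ.kap), (if x' = x ∧ ρ' = ρ then (1 : ℂ) else 0) •
      ((invSqrt2 ^ Λ.k * invSqrt2 ^ Λ.k) • ∑ y : QReg Λ.k, ∑ y' : QReg Λ.k,
        (sPhase Λ.σ y * ySign y y') • basisState (tri x' y' (Λ.A x' y ρ')))) =
      (invSqrt2 ^ Λ.k * invSqrt2 ^ Λ.k) •
        ∑ y : QReg Λ.k, ∑ y' : QReg Λ.k, (sPhase Λ.σ y * ySign y y') • basisState (tri x y' (Λ.A x y ρ)) := by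
    rw [Finset.sum_eq_single x (fun x' _ hx' => Finset.sum_eq_zero fun ρ' _ => by rw [if_neg (fun h => hx' h.1), zero_smul])
      (fun h => absurd (Finset.mem_univ x) h),
      Finset.sum_eq_single ρ (fun ρ' _ hρ' => by rw [if_neg (fun h => hρ' h.2), zero_smul]) (fun h => absurd (Finset.mem_univ ρ) h),
      if_pos ⟨rfl, rfl⟩, one_smul]
  rw [hL, hR] at h
  exact h

/-- **Kitaev's circuit on a good label**: `Y = yv` moves to `P`, shifted by the weighted exponent of
the tests. [cite: Kitaev1995, §3 Lemma 10, §5] -/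
theorem peCirc_mulVec_good (x : QReg Λ.n₁) (hx : Λ.XGood x) {yv : ℕ} (hyv : yv < Λ.Nmod) :
    Λ.peCirc.toMatrix 0 *ᵥ basisState (tri x (fun _ : Fin Λ.k => false) (Λ.yp yv 0)) =
      (invSqrt2 ^ Λ.k * invSqrt2 ^ Λ.k) • ∑ y : QReg Λ.k, ∑ y' : QReg Λ.k, (sPhase Λ.σ y * ySign y y') •
        basisState (tri x y' (Λ.yp 0 ((yv + weightedExp Λ.Bper (List.ofFn y)) % Λ.Nmod))) := by
  rw [Λ.peCirc_mulVec_tri]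
  refine congrArg _ (Finset.sum_congr rfl fun y _ => Finset.sum_congr rfl fun y' _ => ?_)
  rw [Λ.A_good x hx y hyv]

/-- **The read-out stage on a basis label**: `S†` on the control iff the coin `τ` is set, then `H` on
the control. [cite: VanDamSeroussi2002, §3.1 Fact 2] [cite: Kitaev1995, §3 Remark 8] -/
theorem readCirc_mulVec (w : QReg Λ.Wd) :
    Λ.readCirc.toMatrix 0 *ᵥ basisState w =
      ((if w (Λ.fin Λ.tau) ∧ w (Λ.fin Λ.c) then -Complex.I else 1) * invSqrt2) •
        (basisState (Function.update w (Λ.fin Λ.c) false) +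
          (if w (Λ.fin Λ.c) then (-1 : ℂ) else 1) • basisState (Function.update w (Λ.fin Λ.c) true)) := by
  rw [readCirc, QCircuit.toMatrix_append, ← Matrix.mulVec_mulVec, csdWord_mulVec_basisState, Matrix.mulVec_smul, toMatrix_single,
    hOn_mulVec_basisState', smul_smul]

end Layout



end CubicBlock

end VanDamSeroussi

end Literature.Computability.Cryptography
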